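import Mathlib
import HarnessLib
import Summits.Ventures.LatticeQCDFlow.Scaling.EssBhattacharyyaCeilingIntegral
import Summits.Ventures.LatticeQCDFlow.Scaling.IdentityFlowStrictLaws
import Summits.Ventures.LatticeQCDFlow.Scaling.U1IdentityFlowHoldingTime

/-!
# LatticeQCDFlow / Scaling — `ESS < BC²` STRICTLY unless the flow is hit-or-miss; hence
# `I₀(β)²/I₀(2β) < I₀(β/2)²/I₀(β)` for `β ≠ 0`: the ESS rate of the untrained U(1) sampler is
# strictly larger than its acceptance rate

HONEST FRAMING: exact (Metropolis-corrected) sampling algorithms for lattice gauge theory;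
figures of merit are autocorrelation/cost numbers at stated couplings and volumes; no
continuum-physics claim.

Venture `LatticeQCDFlow` (cell pub-lqcd), topic `Scaling`; FANOUT row 3 (`s0-u1-a`, S0-B
implementation A, GEN-15).  NEW WORK of the cell (elementary), not a published result; NO
definition is introduced.  Row 3's `Scaling/EssBhattacharyyaCeilingIntegral` (GEN-15, imported)
proved `(∫p)³ ≤ (∫√(pq))²·∫p²/q` (`ESS ≤ BC²`) on any measure space by two weighted Cauchy–Schwarz
inequalities; here the EQUALITY CASE.  With "hit-or-miss a.e." spelled as in row 3's GEN-13/14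
rigidity files, `∃ c, ∀ᵐ x, 0 < p x → p x / q x = c`:

* `abs_eq_const_ae_of_sq_integral_mul_abs_eq` — equality in the weighted Cauchy–Schwarz
  `(∫K|T|)² = (∫K)(∫KT²)` (`∫K > 0`) forces `|T| = (∫K|T|)/∫K` almost everywhere on `{K > 0}`
  (the discriminant `∫K(|T| − s)²` vanishes);
* **`integral_pow_three_lt_of_not_hitOrMiss`** — for a target `p ≥ 0`, a positive model `q` with
  `∫p²/q < ∞` and a flow that is NOT hit-or-miss a.e.: `(∫p)³ < (∫√(pq))²·∫p²/q`;
  **`essFrac_lt_sq_integral_sqrt`** — normalised: `1/∫p²/q < (∫√(pq))²`, i.e. `ESS < BC²`;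
  `integral_pow_three_eq_of_hitOrMiss`, **`integral_pow_three_eq_iff_hitOrMiss`** — the converse
  and the characterisation `ESS = BC² ↔` hit-or-miss a.e.;
* **`besselI_sq_div_lt_bhatt_sq`** — `I₀(β)²/I₀(2β) < I₀(β/2)²/I₀(β)` for every `β ≠ 0` (the
  untrained one-plaquette U(1) sampler is not hit-or-miss, row 3's `not_hitOrMiss_u1Wilson`,
  GEN-14), and `besselI_pow_three_lt`: `I₀(β)³ < I₀(β/2)²·I₀(2β)`.

Reading (value-free): for every graded block flow the effective sample size decays at a STRICTLY
faster exponential rate than the acceptance (`Scaling/AcceptanceVolumeRateUniversal`: the latter's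
rate is exactly `BC₁²`); for the untrained 2-d U(1) sampler the two per-plaquette rates
`log(I₀(2β)/I₀(β)²) > log(I₀(β)/I₀(β/2)²)` differ at every `β ≠ 0`, so its mean holding time
(`Scaling/U1IdentityFlowHoldingTimeRate`) outgrows the inverse mean acceptance exponentially.
NOT CLAIMED: any value of ours; nothing re-scored, SEALED.md untouched.
-/

namespace Summit.Ventures.LatticeQCDFlow.Theory2

open MeasureTheory Real Set Finset Filter
open Literature.Analysis.FunctionSpaces (besselI besselI_zero_pos)
open Summit.Ventures.LatticeQCDFlow.Scoring (onePlaquetteZ onePlaquetteZ_pos onePlaquetteZ_eq_besselI)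

/-! ## Equality in the weighted Cauchy–Schwarz inequality -/

section Generic

variable {Ω : Type*} [MeasurableSpace Ω] {M : Measure Ω}

/-- **Equality in the weighted Cauchy–Schwarz forces `|T|` to be constant on the support of the
weight**: if `(∫K|T|)² = (∫K)(∫KT²)` with `∫K > 0` then `|T| = (∫K|T|)/∫K` for `M`-a.e. `ω` with
`K ω > 0`. [folklore] -/
theorem abs_eq_const_ae_of_sq_integral_mul_abs_eq {K T : Ω → ℝ} (hK0 : ∀ ω, 0 ≤ K ω)
    (hKi : Integrable K M) (hTm : Measurable T) (hKT2 : Integrable (fun ω => K ω * T ω ^ 2) M)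
    (hZ : 0 < ∫ ω, K ω ∂M)
    (heq : (∫ ω, K ω * |T ω| ∂M) ^ 2 = (∫ ω, K ω ∂M) * ∫ ω, K ω * T ω ^ 2 ∂M) :
    ∀ᵐ ω ∂M, 0 < K ω → |T ω| = (∫ ω, K ω * |T ω| ∂M) / ∫ ω, K ω ∂M := by
  set Z := ∫ ω, K ω ∂M with hZdef
  set A := ∫ ω, K ω * |T ω| ∂M with hAdef
  set s := A / Z with hs
  have hKT := integrable_mul_abs_of_sq hK0 hKi hTm hKT2
  have e : ∀ ω, K ω * (|T ω| - s) ^ 2 = K ω * T ω ^ 2 - 2 * s * (K ω * |T ω|) + s ^ 2 * K ω := by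
    intro ω; rw [sub_sq, sq_abs]; ring
  have hint : Integrable (fun ω => K ω * (|T ω| - s) ^ 2) M := by
    simp_rw [e]; exact (hKT2.sub (hKT.const_mul _)).add (hKi.const_mul _)
  have hQ : ∫ ω, K ω * T ω ^ 2 ∂M = A ^ 2 / Z := by rw [heq, mul_div_cancel_left₀ _ hZ.ne']
  have hval : ∫ ω, K ω * (|T ω| - s) ^ 2 ∂M = 0 := by
    simp_rw [e]
    have hA' : Integrable (fun ω => K ω * T ω ^ 2 - 2 * s * (K ω * |T ω|)) M :=
      hKT2.sub (hKT.const_mul _)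
    rw [integral_add hA' (hKi.const_mul _), integral_sub hKT2 (hKT.const_mul _), integral_const_mul,
      integral_const_mul, hQ, hs]
    have h3 : (A / Z) ^ 2 * Z = A ^ 2 / Z := by
      rw [div_pow, sq Z, div_mul_eq_mul_div, mul_div_mul_right _ _ hZ.ne']
    rw [h3]
    ring
  have hae := (integral_eq_zero_iff_of_nonneg (fun ω => mul_nonneg (hK0 ω) (sq_nonneg _)) hint).1 hval
  filter_upwards [hae] with ω hω hKω
  have h0 : (|T ω| - s) ^ 2 = 0 := by
    have h' : K ω * (|T ω| - s) ^ 2 = 0 := hω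
    rcases mul_eq_zero.1 h' with h | h
    · exact absurd h hKω.ne'
    · exact h
  exact sub_eq_zero.1 ((pow_eq_zero_iff two_ne_zero).1 h0)

end Generic

/-! ## `ESS < BC²` for graded flows -/

section Strict

variable {X : Type*} [MeasurableSpace X] {μ : Measure X}

/-- **`(∫p)³ < (∫√(pq))²·∫p²/q` UNLESS THE FLOW IS HIT-OR-MISS.**  For a target density `p ≥ 0` and a
positive model density `q` with `∫ p²/q < ∞` on any measure space: if the flow is not hit-or-miss
a.e. (`¬ ∃ c, ∀ᵐ x, 0 < p x → p x / q x = c`) then the inequality of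
`Scaling/EssBhattacharyyaCeilingIntegral` is strict. [ours] -/
theorem integral_pow_three_lt_of_not_hitOrMiss {p q : X → ℝ} (hp0 : ∀ a, 0 ≤ p a)
    (hpm : Measurable p) (hpi : Integrable p μ) (hq0 : ∀ a, 0 < q a) (hqm : Measurable q)
    (hqi : Integrable q μ) (h2 : Integrable (fun a => p a ^ 2 / q a) μ)
    (hne : ¬ ∃ c : ℝ, ∀ᵐ a ∂μ, 0 < p a → p a / q a = c) :
    (∫ a, p a ∂μ) ^ 3 < (∫ a, Real.sqrt (p a * q a) ∂μ) ^ 2 * ∫ a, p a ^ 2 / q a ∂μ := by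
  have hle := integral_pow_three_le_sq_integral_sqrt_mul_integral_sq_div hp0 hpm hpi hq0 hqm hqi h2
  refine lt_of_le_of_ne hle fun heq => hne ?_
  set P := ∫ a, p a ∂μ with hP
  set B := ∫ a, Real.sqrt (p a * q a) ∂μ with hB
  set M' := ∫ a, p a * Real.sqrt (p a / q a) ∂μ with hM
  set Q := ∫ a, p a ^ 2 / q a ∂μ with hQ
  have hk0 : ∀ a, 0 ≤ Real.sqrt (p a * q a) := fun a => Real.sqrt_nonneg _
  have hki : Integrable (fun a => Real.sqrt (p a * q a)) μ :=
    integrable_sqrt_mul hp0 hpm hpi (fun a => (hq0 a).le) hqm hqi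
  have hTm : Measurable fun a => Real.sqrt (p a / q a) := (hpm.div hqm).sqrt
  have hT0 : ∀ a, 0 ≤ Real.sqrt (p a / q a) := fun a => Real.sqrt_nonneg _
  have hMi := integrable_mul_sqrt_div hp0 hpm hpi hq0 hqm h2
  have e1 : ∀ a, Real.sqrt (p a * q a) * Real.sqrt (p a / q a) = p a := by
    intro a
    rw [← Real.sqrt_mul (mul_nonneg (hp0 a) (hq0 a).le), show p a * q a * (p a / q a) = p a ^ 2 by
      rw [mul_assoc, mul_div_cancel₀ _ (hq0 a).ne', sq], Real.sqrt_sq (hp0 a)]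
  have e2 : ∀ a, Real.sqrt (p a * q a) * Real.sqrt (p a / q a) ^ 2 = p a * Real.sqrt (p a / q a) := by
    intro a; rw [sq, ← mul_assoc, e1 a]
  have e3 : ∀ a, p a * Real.sqrt (p a / q a) ^ 2 = p a ^ 2 / q a := by
    intro a; rw [Real.sq_sqrt (div_nonneg (hp0 a) (hq0 a).le), sq, mul_div_assoc]
  have hKT2 : Integrable (fun a => Real.sqrt (p a * q a) * Real.sqrt (p a / q a) ^ 2) μ := by
    simp_rw [e2]; exact hMi
  have h1 := sq_integral_mul_abs_le hk0 hki hTm hKT2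
  have hKT2' : Integrable (fun a => p a * Real.sqrt (p a / q a) ^ 2) μ := by
    simp_rw [e3]; exact h2
  have h2' := sq_integral_mul_abs_le hp0 hpi hTm hKT2'
  simp_rw [abs_of_nonneg (hT0 _), e3] at h2'
  have h1' := h1
  simp_rw [abs_of_nonneg (hT0 _), e1, e2] at h1'
  -- `P = 0`: then `p = 0` a.e., hit-or-miss with any constant
  have hP0 : 0 ≤ P := integral_nonneg hp0
  have hB0 : 0 ≤ B := integral_nonneg hk0
  have hM0 : 0 ≤ M' := integral_nonneg fun a => mul_nonneg (hp0 a) (hT0 a)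
  have hQ0 : 0 ≤ Q := integral_nonneg fun a => div_nonneg (sq_nonneg _) (hq0 a).le
  rcases hP0.eq_or_lt with hPz | hPpos
  · have hae : ∀ᵐ a ∂μ, p a = 0 := by
      have := (integral_eq_zero_iff_of_nonneg hp0 hpi).1 hPz.symm
      exact this.mono fun a ha => ha
    exact ⟨0, hae.mono fun a ha hpa => absurd hpa (by rw [ha]; exact lt_irrefl 0)⟩
  -- `P > 0`: both Cauchy–Schwarz steps are equalities; the first forces `√(p/q)` constant on `{p>0}`
  have hCS1 : P ^ 2 = B * M' := by
    have h4 : P ^ 4 ≤ B ^ 2 * M' ^ 2 := by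
      calc P ^ 4 = (P ^ 2) ^ 2 := by ring
        _ ≤ (B * M') ^ 2 := pow_le_pow_left₀ (sq_nonneg _) h1' 2
        _ = B ^ 2 * M' ^ 2 := by ring
    have h5 : B ^ 2 * M' ^ 2 ≤ B ^ 2 * (P * Q) := mul_le_mul_of_nonneg_left h2' (sq_nonneg _)
    have h6 : B ^ 2 * (P * Q) = P ^ 4 := by rw [show B ^ 2 * (P * Q) = P * (B ^ 2 * Q) by ring, ← heq]; ring
    have h7 : (P ^ 2) ^ 2 = (B * M') ^ 2 := by nlinarith
    exact (sq_eq_sq₀ (sq_nonneg P) (mul_nonneg hB0 hM0)).1 h7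
  have hBpos : 0 < B := by
    rcases hB0.eq_or_lt with hBz | hBpos
    · exfalso; rw [← hBz, zero_mul] at hCS1; exact (pow_pos hPpos 2).ne' hCS1
    · exact hBpos
  have heqCS : (∫ a, Real.sqrt (p a * q a) * |Real.sqrt (p a / q a)| ∂μ) ^ 2
      = (∫ a, Real.sqrt (p a * q a) ∂μ) * ∫ a, Real.sqrt (p a * q a) * Real.sqrt (p a / q a) ^ 2 ∂μ := by
    simp_rw [abs_of_nonneg (hT0 _), e1, e2]; exact hCS1
  have hconst := abs_eq_const_ae_of_sq_integral_mul_abs_eq hk0 hki hTm hKT2 hBpos heqCS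
  set s := (∫ a, Real.sqrt (p a * q a) * |Real.sqrt (p a / q a)| ∂μ) / ∫ a, Real.sqrt (p a * q a) ∂μ
  refine ⟨s ^ 2, hconst.mono fun a ha hpa => ?_⟩
  have hk : 0 < Real.sqrt (p a * q a) := Real.sqrt_pos.2 (mul_pos hpa (hq0 a))
  have h := ha hk
  rw [abs_of_nonneg (hT0 a)] at h
  rw [← h, Real.sq_sqrt (div_nonneg (hp0 a) (hq0 a).le)]

/-- **`ESS < BC²` for a graded flow** (normalised target, `∫p²/q < ∞`, not hit-or-miss a.e.):
`1/∫p²/q < (∫√(pq))²`. [ours] -/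
theorem essFrac_lt_sq_integral_sqrt {p q : X → ℝ} (hp0 : ∀ a, 0 ≤ p a) (hpm : Measurable p)
    (hpi : Integrable p μ) (hp1 : ∫ a, p a ∂μ = 1) (hq0 : ∀ a, 0 < q a) (hqm : Measurable q)
    (hqi : Integrable q μ) (h2 : Integrable (fun a => p a ^ 2 / q a) μ)
    (hne : ¬ ∃ c : ℝ, ∀ᵐ a ∂μ, 0 < p a → p a / q a = c) :
    (∫ a, p a ∂μ) ^ 2 / ∫ a, p a ^ 2 / q a ∂μ < (∫ a, Real.sqrt (p a * q a) ∂μ) ^ 2 := by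
  have h := integral_pow_three_lt_of_not_hitOrMiss hp0 hpm hpi hq0 hqm hqi h2 hne
  rw [hp1, one_pow] at h ⊢
  have hQ0 : 0 ≤ ∫ a, p a ^ 2 / q a ∂μ := integral_nonneg fun a => div_nonneg (sq_nonneg _) (hq0 a).le
  rcases hQ0.eq_or_lt with hQ | hQ
  · rw [← hQ, mul_zero] at h; norm_num at h
  · rwa [div_lt_iff₀ hQ]


/-- **The converse: a hit-or-miss flow attains `ESS = BC²`.**  If `p/q = c` a.e. on `{p > 0}` then
`(∫p)³ = (∫√(pq))²·∫p²/q` (on `{p > 0}`: `√(pq) = p/√c`, `p²/q = c·p`; if `{p > 0}` is null both sides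
vanish). [ours] -/
theorem integral_pow_three_eq_of_hitOrMiss {p q : X → ℝ} (hp0 : ∀ a, 0 ≤ p a) (hq0 : ∀ a, 0 < q a)
    (h : ∃ c : ℝ, ∀ᵐ a ∂μ, 0 < p a → p a / q a = c) :
    (∫ a, p a ∂μ) ^ 3 = (∫ a, Real.sqrt (p a * q a) ∂μ) ^ 2 * ∫ a, p a ^ 2 / q a ∂μ := by
  obtain ⟨c, hc⟩ := h
  rcases le_or_gt c 0 with hc0 | hc0
  · -- `c ≤ 0`: the target vanishes a.e.
    have hp : ∀ᵐ a ∂μ, p a = 0 := hc.mono fun a ha => by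
      rcases (hp0 a).eq_or_lt with h0 | hpos
      · exact h0.symm
      · exact absurd (ha hpos) (ne_of_gt (lt_of_le_of_lt hc0 (div_pos hpos (hq0 a))))
    have h1 : ∫ a, p a ∂μ = 0 :=
      (integral_congr_ae (hp.mono fun a ha => by simp [ha])).trans (integral_zero _ _)
    have h2 : ∫ a, Real.sqrt (p a * q a) ∂μ = 0 :=
      (integral_congr_ae (hp.mono fun a ha => by simp [ha])).trans (integral_zero _ _)
    rw [h1, h2]; ring
  · -- `c > 0`: `√(pq) = p/√c` and `p²/q = c p` almost everywhere
    have hsc : 0 < Real.sqrt c := Real.sqrt_pos.2 hc0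
    have e1 : ∀ᵐ a ∂μ, Real.sqrt (p a * q a) = p a / Real.sqrt c := hc.mono fun a ha => by
      rcases (hp0 a).eq_or_lt with h0 | hpos
      · rw [← h0, zero_mul, Real.sqrt_zero, zero_div]
      · have hq : q a = p a / c := by
          rw [eq_div_iff hc0.ne', ← ha hpos, mul_comm, div_mul_cancel₀ _ (hq0 a).ne']
        rw [hq, show p a * (p a / c) = (p a / Real.sqrt c) ^ 2 by
          rw [div_pow, Real.sq_sqrt hc0.le]; ring, Real.sqrt_sq (div_nonneg hpos.le hsc.le)]
    have e2 : ∀ᵐ a ∂μ, p a ^ 2 / q a = c * p a := hc.mono fun a ha => by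
      rcases (hp0 a).eq_or_lt with h0 | hpos
      · rw [← h0]; ring
      · have hq : q a = p a / c := by
          rw [eq_div_iff hc0.ne', ← ha hpos, mul_comm, div_mul_cancel₀ _ (hq0 a).ne']
        rw [hq]; field_simp
    rw [integral_congr_ae e1, integral_congr_ae e2, integral_div, integral_const_mul, div_pow,
      Real.sq_sqrt hc0.le]
    field_simp

/-- **`ESS = BC²` IFF THE FLOW IS HIT-OR-MISS** (target `p ≥ 0`, model `q > 0`, `p, q, p²/q ∈ L¹`):
`(∫p)³ = (∫√(pq))²·∫p²/q ↔ ∃ c, ∀ᵐ x, 0 < p x → p x / q x = c`. [ours] -/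
theorem integral_pow_three_eq_iff_hitOrMiss {p q : X → ℝ} (hp0 : ∀ a, 0 ≤ p a) (hpm : Measurable p)
    (hpi : Integrable p μ) (hq0 : ∀ a, 0 < q a) (hqm : Measurable q) (hqi : Integrable q μ)
    (h2 : Integrable (fun a => p a ^ 2 / q a) μ) :
    (∫ a, p a ∂μ) ^ 3 = (∫ a, Real.sqrt (p a * q a) ∂μ) ^ 2 * ∫ a, p a ^ 2 / q a ∂μ ↔
      ∃ c : ℝ, ∀ᵐ a ∂μ, 0 < p a → p a / q a = c := by
  refine ⟨fun heq => ?_, integral_pow_three_eq_of_hitOrMiss hp0 hq0⟩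
  by_contra hne
  exact (integral_pow_three_lt_of_not_hitOrMiss hp0 hpm hpi hq0 hqm hqi h2 hne).ne heq

end Strict

/-! ## The untrained U(1) sampler: the two rates differ for `β ≠ 0` -/

/-- **`I₀(β)²/I₀(2β) < I₀(β/2)²/I₀(β)` for every `β ≠ 0`** — one-plaquette `ESS₁ < BC₁²` (the
untrained sampler is not hit-or-miss, row 3 GEN-14). [ours] -/
theorem besselI_sq_div_lt_bhatt_sq {β : ℝ} (hβ : β ≠ 0) :
    besselI 0 β ^ 2 / besselI 0 (2 * β) < besselI 0 (β / 2) ^ 2 / besselI 0 β := by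
  have h := essFrac_lt_sq_integral_sqrt (μ := volume.restrict (Ioc (0 : ℝ) (2 * π)))
    (fun θ => (u1Wilson_pos β θ).le) (measurable_u1Wilson β) (integrable_u1Wilson β)
    (integral_u1Wilson β) (fun _ => by positivity) measurable_const integrable_u1Haar
    (integrable_u1Wilson_sq_div β) (not_hitOrMiss_u1Wilson hβ)
  rw [integral_u1Wilson, integral_u1Wilson_sq_div, integral_sqrt_u1Wilson_mul, one_pow, div_pow,
    Real.sq_sqrt (besselI_zero_pos β).le, one_div, inv_div] at h
  exact h

/-- **`I₀(β)³ < I₀(β/2)²·I₀(2β)`** for every `β ≠ 0`. [ours] -/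
theorem besselI_pow_three_lt {β : ℝ} (hβ : β ≠ 0) :
    besselI 0 β ^ 3 < besselI 0 (β / 2) ^ 2 * besselI 0 (2 * β) := by
  have h := besselI_sq_div_lt_bhatt_sq hβ
  have h1 := besselI_zero_pos β
  have h2 := besselI_zero_pos (2 * β)
  rw [div_lt_div_iff₀ h2 h1] at h
  nlinarith [h]

end Summit.Ventures.LatticeQCDFlow.Theory2
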